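import Summits.CriticalPhenomena.PercolationContinuityZ3.Theorems.Transplant.SkelSign2ParamsAtQ
import Summits.CriticalPhenomena.PercolationContinuityZ3.Theorems.Transplant.SkelKitResiduesHab
import HarnessLib

/-!
# D″ L7′ params, part 8: THE (C) CORRIDOR CHAIN COUNTS of `signChoice₂` — for a probe with run axis `a` (`∥ := a`, `⊥ := oth a`): the Loc rounds
# `NC₁` (axis ⊥, from `3 r⊥` down to `ℓ₀⊥`, shrink `L e⊥ − R′` per round), `NC₂` (axis ∥, from `3 r∥ + (NC₁+1)R′` down to `ℓ₀∥`), and the band's far-line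
# count `NC₃` (stride `sC∥ = (L−2)e∥ + R′`, start `q = ℓ₀∥`, target rows `[17 r∥, 22 r∥]`), with the REACH facts p5-g6's `Loc.schedule_core_last` /
# `Corr` rooms ask (`L₀ ≤ (N+1)(ℓ₁ − R′) + ℓ₀`, `17 r∥ ≤ q + (N₃+1)s₁ ≤ 22 r∥`) and the LENGTH BOUND **`NC₁ + NC₂ + NC₃ + 2 ≤ 703 ≤ Skel.nmaxC`** (the `hn`
# of `Skelφ.reachOblRH_of_schedules`; F-DP4-1 closed by R1 in numbers: `NC₁ ≤ 60`, `NC₂ ≤ 61`, `NC₃ ≤ 578` from `A ≤ 17L + 16`, `L ≥ 5`, `4000 R′ ≤ e`)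
# — ledger SIGN-PARAMS.md §4 (A4)/(A6), §5

builds on p205010 (kernel theorem, internal audit signed; external expert review pending) — nothing in this file uses p205010.
Status sentence (coordinator 2026-08-20T04:30Z): "θ(p_c) = 0 on ℤ^d, all d ≥ 2 — kernel-verified (Lean 4/Mathlib, standard axioms); internal adversarial
audit SIGNED 2026-08-20 04:29Z; external expert review pending."
Lane `prim-bschramm-*`, seat `prim-bschramm-stmt` (gen 9); helper file (`--supports stmt-CriticalPhenomena-4575`).
[cite: KozmaNitzan2024, §4 Lemma 12 (pp. 23–25), Theorem 6 Step IV (p. 30)]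
-/

noncomputable section

open scoped Classical

namespace Summit.CriticalPhenomena.PercolationContinuityZ3.Theorems.Transplant

namespace PlanarSkeletonSign

namespace Sgn₂

open Literature.Probability.Percolation Literature.Probability.LatticeModels SimpleGraph
open Literature.Probability.Percolation.KozmaNitzan.Cells (oth)
open SkelConc (Consts)
open Sgn (K a A L twenty_le_K one_le_a hundred_le_A K_le_A five_le_L sixteen_L_le_A δkit δI m₀ Mu ρz M T₀ Kd Rseed rs cU sB B kP NP Lcnt Rlev R' η reachK Sz L_hyps)

section Defs

variable (κ : Consts) {V : Type} [DecidableEq V] [Countable V] {G : SimpleGraph V} [G.LocallyFinite] (Φ : PlanarSkeletonSign G)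
  (p : unitInterval) (O : Skelφ.StepI.Out V) (a : Fin 2)

/-- **Loc phase 1 rounds** (axis `⊥ = oth a`): `NC₁ := (3 r⊥ − ℓ₀⊥) / (L e⊥ − R′)`. [this work] -/
def NC₁ : ℕ := (3 * (cells κ Φ p O).r (oth a) - ℓ₀ κ Φ p O (oth a)) / (ℓtop κ Φ p O (oth a) - R' κ Φ p O)

/-- **Loc phase 2 rounds** (axis `∥ = a`): `NC₂ := (3 r∥ + (NC₁+1) R′ − ℓ₀∥) / (L e∥ − R′)`. [this work] -/
def NC₂ : ℕ := (3 * (cells κ Φ p O).r a + (NC₁ κ Φ p O a + 1) * R' κ Φ p O - ℓ₀ κ Φ p O a) / (ℓtop κ Φ p O a - R' κ Φ p O)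

/-- **The band's far-line count** (axis `∥`, stride `sC∥`, start `q = ℓ₀∥`): `NC₃ := (17 r∥ − ℓ₀∥) / sC∥`. [this work] -/
def NC₃ : ℕ := (17 * (cells κ Φ p O).r a - ℓ₀ κ Φ p O a) / sC κ Φ p O a

end Defs

/-- Ceiling arithmetic: `x < (x / y + 1) * y` for `0 < y`. [folklore] -/
theorem lt_div_succ_mul {x y : ℕ} (hy : 0 < y) : x < (x / y + 1) * y := by
  rw [Nat.add_mul, Nat.one_mul]
  have := Nat.div_add_mod x y
  have := Nat.mod_lt x hy
  rw [Nat.mul_comm] ; omega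

section AtQ

variable {κ : Consts} {V : Type} [DecidableEq V] [Countable V] {G : SimpleGraph V} [G.LocallyFinite] {Φ : PlanarSkeletonSign G}
  {t : V} {p : unitInterval} {hC : Φ.CylSubcritical p} {O : Skelφ.StepI.Out V} {q : unitInterval}
  (hat : (choiceAt κ Φ t p hC).AtQ O q)
include hat

/-- The unit sandwich used by every count: `ℓtop i − R′ ≥ 1`, `sC i ≥ 1`, `ℓ₀ i ≤ r i`, `A ≤ 17 L + 16`, `4000 R′ ≤ e i`, `r i = A e i`. [folklore] -/
theorem count_units_at (i : Fin 2) : 0 < ℓtop κ Φ p O i - R' κ Φ p O ∧ 0 < sC κ Φ p O i ∧ ℓ₀ κ Φ p O i ≤ (cells κ Φ p O).r i ∧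
    A κ ≤ 17 * L κ + 16 ∧ 4000 * R' κ Φ p O ≤ e κ Φ p O i ∧ (cells κ Φ p O).r i = A κ * e κ Φ p O i := by
  have hs := strides_at hat i
  have hu := units_large_at hat i
  have he := e_le_r_at hat i
  have h0 := (Mu_succ_le_ℓ₀_at hat i).1
  have hA := hundred_le_A κ
  have hL17 : A κ ≤ 17 * L κ + 16 := by unfold L; omega
  refine ⟨by omega, by omega, (Nat.sub_le _ _).trans he.1, hL17, ?_, cells_r_at hat i⟩
  calc 4000 * R' κ Φ p O ≤ 40 * A κ * R' κ Φ p O := by nlinarith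
    _ ≤ _ := hu.1

/-- **Loc phase 1 reaches `ℓ₀⊥`**: `3 r⊥ ≤ (NC₁ + 1)(L e⊥ − R′) + ℓ₀⊥`. [folklore] -/
theorem loc₁_reach (a : Fin 2) : 3 * (cells κ Φ p O).r (oth a) ≤
    (NC₁ κ Φ p O a + 1) * (ℓtop κ Φ p O (oth a) - R' κ Φ p O) + ℓ₀ κ Φ p O (oth a) := by
  have h := lt_div_succ_mul (x := 3 * (cells κ Φ p O).r (oth a) - ℓ₀ κ Φ p O (oth a)) (count_units_at hat (oth a)).1
  unfold NC₁; omega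

/-- **Loc phase 2 reaches `ℓ₀∥`**: `3 r∥ + (NC₁+1) R′ ≤ (NC₂ + 1)(L e∥ − R′) + ℓ₀∥`. [folklore] -/
theorem loc₂_reach (a : Fin 2) : 3 * (cells κ Φ p O).r a + (NC₁ κ Φ p O a + 1) * R' κ Φ p O ≤
    (NC₂ κ Φ p O a + 1) * (ℓtop κ Φ p O a - R' κ Φ p O) + ℓ₀ κ Φ p O a := by
  have h := lt_div_succ_mul (x := 3 * (cells κ Φ p O).r a + (NC₁ κ Φ p O a + 1) * R' κ Φ p O - ℓ₀ κ Φ p O a) (count_units_at hat a).1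
  unfold NC₂; omega

/-- **The band reaches the target rows**: `17 r∥ ≤ ℓ₀∥ + (NC₃ + 1)·sC∥ ≤ 22 r∥`. [folklore] -/
theorem band_reach (a : Fin 2) : 17 * (cells κ Φ p O).r a ≤ ℓ₀ κ Φ p O a + (NC₃ κ Φ p O a + 1) * sC κ Φ p O a ∧
    ℓ₀ κ Φ p O a + (NC₃ κ Φ p O a + 1) * sC κ Φ p O a ≤ 22 * (cells κ Φ p O).r a := by
  have hu := count_units_at hat a
  have hs := strides_at hat a
  have h := lt_div_succ_mul (x := 17 * (cells κ Φ p O).r a - ℓ₀ κ Φ p O a) hu.2.1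
  have hle : NC₃ κ Φ p O a * sC κ Φ p O a ≤ 17 * (cells κ Φ p O).r a - ℓ₀ κ Φ p O a := by unfold NC₃; exact Nat.div_mul_le_self _ _
  -- `sC ≤ L e ≤ A e = r` (`L ≤ A`)
  have hLA : L κ ≤ A κ := by unfold L; omega
  have hsC : sC κ Φ p O a ≤ (cells κ Φ p O).r a := by
    rw [hu.2.2.2.2.2]
    have : ℓtop κ Φ p O a ≤ A κ * e κ Φ p O a := by unfold ℓtop; exact Nat.mul_le_mul_right _ hLA
    omega
  constructor
  · unfold NC₃ at h ⊢; omega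
  · rw [Nat.add_mul, Nat.one_mul]; omega

/-- **THE COUNT BOUNDS**: `NC₁ ≤ 60`, `NC₂ ≤ 61`, `NC₃ ≤ 578` (from `A ≤ 17L + 16`, `L ≥ 5`, `4000 R′ ≤ e`, `r = A e`). [folklore] -/
theorem counts_le (a : Fin 2) : NC₁ κ Φ p O a ≤ 60 ∧ NC₂ κ Φ p O a ≤ 61 ∧ NC₃ κ Φ p O a ≤ 578 := by
  have hL := five_le_L κ
  obtain ⟨hy1, -, -, hA17, hR1, hr1⟩ := count_units_at hat (oth a)
  obtain ⟨hy0, hs0, -, -, hR0, hr0⟩ := count_units_at hat a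
  have ht1 := (extents_eq_at hat (oth a)).2.2
  have ht0 := (extents_eq_at hat a).2.2
  have hE1 := one_le_e_at hat (oth a)
  have hE0 := one_le_e_at hat a
  set E1 := e κ Φ p O (oth a)
  set E0 := e κ Φ p O a
  set R := R' κ Φ p O
  -- linear consequences of `A ≤ 17L + 16` and `5 ≤ L`, multiplied by the unit
  have hAE1 : A κ * E1 ≤ 17 * (L κ * E1) + 16 * E1 :=
    calc A κ * E1 ≤ (17 * L κ + 16) * E1 := Nat.mul_le_mul_right _ hA17
      _ = 17 * (L κ * E1) + 16 * E1 := by ring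
  have hAE0 : A κ * E0 ≤ 17 * (L κ * E0) + 16 * E0 :=
    calc A κ * E0 ≤ (17 * L κ + 16) * E0 := Nat.mul_le_mul_right _ hA17
      _ = 17 * (L κ * E0) + 16 * E0 := by ring
  have hL1 : 5 * E1 ≤ L κ * E1 := Nat.mul_le_mul_right _ hL
  have hL0 : 5 * E0 ≤ L κ * E0 := Nat.mul_le_mul_right _ hL
  have hsub1 : ℓtop κ Φ p O (oth a) - R = L κ * E1 - R := by rw [ht1]
  have hsub0 : ℓtop κ Φ p O a - R = L κ * E0 - R := by rw [ht0]
  -- NC₁ < 61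
  have h1 : NC₁ κ Φ p O a < 61 := by
    unfold NC₁
    rw [Nat.div_lt_iff_lt_mul hy1, hr1, hsub1]
    have : 3 * (A κ * E1) < 61 * (L κ * E1 - R) := by omega
    exact lt_of_le_of_lt (Nat.sub_le _ _) this
  -- NC₂ < 62
  have h2 : NC₂ κ Φ p O a < 62 := by
    unfold NC₂
    rw [Nat.div_lt_iff_lt_mul hy0, hr0, hsub0]
    have hN : (NC₁ κ Φ p O a + 1) * R ≤ 61 * R := Nat.mul_le_mul_right _ (by omega)
    have : 3 * (A κ * E0) + (NC₁ κ Φ p O a + 1) * R < 62 * (L κ * E0 - R) := by omega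
    exact lt_of_le_of_lt (Nat.sub_le _ _) this
  -- NC₃ < 579
  have h3 : NC₃ κ Φ p O a < 579 := by
    unfold NC₃
    rw [Nat.div_lt_iff_lt_mul hs0, hr0]
    have hsC : 579 * ((L κ - 2) * E0) ≤ 579 * sC κ Φ p O a := by unfold sC; exact Nat.mul_le_mul_left _ (Nat.le_add_right _ _)
    have hkey : 17 * A κ + 1 ≤ 579 * (L κ - 2) := by omega
    have hm : 17 * (A κ * E0) + E0 ≤ 579 * ((L κ - 2) * E0) :=
      calc 17 * (A κ * E0) + E0 = (17 * A κ + 1) * E0 := by ring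
        _ ≤ 579 * (L κ - 2) * E0 := Nat.mul_le_mul_right _ hkey
        _ = 579 * ((L κ - 2) * E0) := by ring
    have : 17 * (A κ * E0) < 579 * sC κ Φ p O a := by omega
    exact lt_of_le_of_lt (Nat.sub_le _ _) this
  omega

/-- **`hn`: the (C) corridor chain has at most `703 ≤ nmaxC` steps** (`Corr.schedule.N = NC₁ + 1 + NC₂ + 1 + NC₃`). [folklore] -/
theorem corridor_length_le (a : Fin 2) : NC₁ κ Φ p O a + 1 + NC₂ κ Φ p O a + 1 + NC₃ κ Φ p O a ≤ Skel.nmaxC := by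
  have h := counts_le hat a
  unfold Skel.nmaxC; omega

end AtQ

end Sgn₂

end PlanarSkeletonSign

end Summit.CriticalPhenomena.PercolationContinuityZ3.Theorems.Transplant

end
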